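import Literature.NumberTheory.LFunctions.NoRealZeroCertificateReplayTable18
import Literature.NumberTheory.LFunctions.NoRealZeroCertificateReplayTable19A
import Literature.NumberTheory.LFunctions.NoRealZeroCertificateReplayTable19B
import Literature.NumberTheory.LFunctions.NoRealZeroCertificateReplayTable19C
import Literature.NumberTheory.LFunctions.NoRealZeroCertificateReplayTable19D
import Literature.NumberTheory.LFunctions.NoRealZeroCertificateReplayTable19E
import Literature.NumberTheory.LFunctions.NoRealZeroCertificateReplayTable19F
import Literature.NumberTheory.LFunctions.NoRealZeroCertificateReplayTable19G
import Literature.NumberTheory.LFunctions.NoRealZeroCertificateReplayTable19H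
import Literature.NumberTheory.LFunctions.NoRealZeroCertificateReplayTable19I
import Literature.NumberTheory.LFunctions.NoRealZeroCertificateReplayTable19J
import Literature.NumberTheory.LFunctions.NoRealZeroCertificateReplayTable19K
import Literature.NumberTheory.LFunctions.NoRealZeroCertificateReplayTable19L
import Literature.NumberTheory.LFunctions.NoRealZeroCertificateReplayTable19M
import HarnessLib

/-!
# Kernel replay of the Lu–Zaman–Zhao certificates: the verified prime table for `p < 2^19`

Topic `Literature/NumberTheory/LFunctions`. Assembly of the kernel-verified prime tables of heavy tier 19:
`table19` = the concatenation of parts A, B, C, D, E, F, G, H, I, J, K, L, M (the 20390 primes `2^18 < p < 2^19`, verified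
entrywise in `NoRealZeroCertificateReplayTable19<part>.lean`), `table19_sorted`, `table19_valid`, and
**`table15_19 = table15_18 ++ table19`** with **`table15_19_valid : TableValid table15_19`** (junction by the bound
`262144`, `TableValid.append_of_bound`). Used by the `…ReplayHeavy19N*` files (heavy discriminants whose Table-1
certificate at `λ = 1.6`, `c = 1/5` needs primes in `(2^18, 2^19)`; Lu–Zaman–Zhao arXiv:2602.03626 §3) through `checkListK`.

## References

* W. Lu, A. Zaman, K. Zhao, *Dirichlet L-functions of quadratic characters have no exceptional
  zeros for moduli up to 10¹⁰*, Math. Comp. (2026), arXiv:2602.03626, §2.2–§3. [LuZamanZhao2026]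
-/

namespace Literature.NumberTheory.LFunctions
namespace LuZamanZhao2026
namespace Replay

/-- **The verified prime table for `2^18 < p < 2^19`** (20390 primes). [folklore] -/
def table19 : List PRow :=
  table19A ++ (table19B ++ (table19C ++ (table19D ++ (table19E ++ (table19F ++ (table19G ++ (table19H ++ (table19I ++ (table19J ++ (table19K ++ (table19L ++ (table19M))))))))))))

set_option maxHeartbeats 0 in
/-- The primes of `table19` increase strictly. [cite: LuZamanZhao2026, §2.2 and (2.3)] -/
theorem table19_sorted : sortedCheck table19 = true := by
  decide +kernel

/-- **`table19` is a valid table.** [cite: LuZamanZhao2026, §2.2 and (2.3)] -/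
theorem table19_valid : TableValid table19 :=
  tableValid_of (entryValid_append table19A_entryValid (entryValid_append table19B_entryValid (entryValid_append table19C_entryValid (entryValid_append table19D_entryValid (entryValid_append table19E_entryValid (entryValid_append table19F_entryValid (entryValid_append table19G_entryValid (entryValid_append table19H_entryValid (entryValid_append table19I_entryValid (entryValid_append table19J_entryValid (entryValid_append table19K_entryValid (entryValid_append table19L_entryValid table19M_entryValid)))))))))))) table19_sorted

/-- **The verified prime table for `p < 2^19`**: `table15_19 = table15_18 ++ table19`. [folklore] -/
def table15_19 : List PRow :=
  table15_18 ++ table19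

set_option maxHeartbeats 0 in
/-- Every prime of `table15_18` is `< 262144`. [cite: LuZamanZhao2026, §2.2 and (2.3)] -/
theorem table15_18_allPLt_262144 : allPLt table15_18 262144 = true := by
  decide +kernel

set_option maxHeartbeats 0 in
/-- Every prime of `table19` is `≥ 262144`. [cite: LuZamanZhao2026, §2.2 and (2.3)] -/
theorem table19_allPGe : allPGe table19 262144 = true := by
  decide +kernel

/-- **`table15_19` is a valid table** — the hypothesis of `certifiedAt_of_checkListK` for heavy tier 19.
[cite: LuZamanZhao2026, §2.2 and (2.3)] -/
theorem table15_19_valid : TableValid table15_19 :=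
  table15_18_valid.append_of_bound table19_valid 262144 table15_18_allPLt_262144 table19_allPGe

end Replay
end LuZamanZhao2026
end Literature.NumberTheory.LFunctions
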